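import Summits.Ventures.AbcSig.Rows.TemplateAB
import Summits.Ventures.AbcSig.Levels.N58
import Summits.Ventures.AbcSig.Levels.N232

/-!
# Venture AbcSig — ROW `C2aL29A45AB`: `29^m·xⁿ + 2^a·yⁿ = z²` (SECOND coefficient distribution of the cell; the distribution `xⁿ + 2^a·29^m·yⁿ = z²` is `Rows/C2aL29A45.lean`), class `a 45` (GENERATED by plean/leanrow.py)

HONEST FRAMING. A row of a COMPUTATION cell (`pub-abcsig`); a CONDITIONAL theorem, no claim on ABC or any summit.
Hypotheses: `BS04Package` (CITED), `DataComplete` at levels [58, 232] (COMPUTED, two-engine certified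
level files), and the listed per-orbit exclusions `hX_…` (CITED — e.g. the cell's M6 Eisenstein certificates; the
row's R5 cell names each). Everything else is kernel-checked (`Rows/TemplateAB.lean`, `Levels/N….lean` — the SAME level files as the first distribution). Exponent
range: prime `n ≥ 11`, `n ≠ 29`; `B = 2^a 29^m` with `a, m < n` (n-th-power free).
Row of record:  (sha256 ; SIGNED 2026-08-22T08:50:29Z by referee (ref-g4)); its R0: THEOREM (sieve-complete) for all primes n >= 11 with n coprime to 464 — class: REPRODUCTION candidate of a BS04 Thm 1.3 cell (both distributions of AB; engines . Exponents left open by the row of record are excluded here via ; kernel-sieve residuals the row of record closes by a cell module (M6 Eisenstein / M4 Kraus certificates) appear as CITED hypotheses .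
-/

namespace Summit.Ventures.AbcSig

/-- Row `C2aL29A45AB`: second coefficient distribution `29^m·xⁿ + 2^a·yⁿ = z²` (see module docstring). -/
theorem row_C2aL29A45AB (M : NewformModel) (hP : M.BS04Package)
    (hD58 : M.DataComplete 58 level58Orbits) (hD232 : M.DataComplete 232 level232Orbits)
    (n : ℕ) (hn : n.Prime) (hmin : 11 ≤ n) (hnℓ : n ≠ 29) (a m : ℕ) (ha : a = 4 ∨ a = 5) (hm : 1 ≤ m) (han : a < n) (hmn : m < n)
    
    (x y z : ℤ) (hxy1 : x * y ≠ 1) (hxy2 : x * y ≠ -1) : ¬ IsPrimitiveSolution (29 ^ m) (2 ^ a) 1 n x y z := by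
  have hℓ : Nat.Prime 29 := by norm_num
  have h7 : 7 ≤ n := by omega
  have hS58 :=
    (level58_sieve n hn h7 (fun o => M.Excludes 58 o (famAB (29 ^ m) (2 ^ a) n (fun _ _ => True))) (fun h => absurd h (by simp only [List.mem_cons, List.not_mem_nil, or_false]; omega)))
  have hS232 :=
    (level232_sieve n hn h7 (fun o => M.Excludes 232 o (famAB (29 ^ m) (2 ^ a) n (fun _ _ => True))) (fun h => absurd h (by simp only [List.mem_cons, List.not_mem_nil, or_false]; omega)))
  exact rowC2aAB_a45 29 hℓ (by norm_num) M hP n hn h7 hnℓ hD232 hD58 a m ha hm han hmn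
    hS232
    hS58 x y z hxy1 hxy2

end Summit.Ventures.AbcSig
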